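import Mathlib
import Summits.Ventures.PercRepro2.AbsPattern

/-!
# The STEP family implies the BAL family on every abstract pattern
(seat mine-b, cell pub-perc-repro2; conjectures/MINE-B.md §12)

`BAL(a, b)`: `T(a−1, b+1) ≤ T(a, b)` for `1 ≤ a ≤ b`.  On the diagonal it is `STEP(a−1, a+1)`
(`absH_step_iff_bal`); off the diagonal, `STEP(a−1, b+1)` reads
`T(a−1, b+1) − T(a, b+1) ≤ T(a, b) − T(a+1, b)`, so `BAL(a, b)` follows from it and `BAL(a+1, b)`.
Hence the whole STEP family of a pattern (all `i + 2 ≤ j`) gives the whole BAL family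
(`absT_bal_of_step`) — the abstract form of «STEP ⇒ BAL ⇒ the two-copy B2 coefficient» (§10.3),
and, through the bridge of PackPattern.lean, the log-concave tail of the packing number for every
product measure.
-/

open Finset

namespace Summit.Ventures.PercRepro2

namespace StepZero

open ReimerCube

variable {E : Type*} [DecidableEq E]

/-- **STEP on every `(i, j)` of a pattern implies BAL on every `(a, b)`**:
`T(a', b+1) ≤ T(a'+1, b)` for all `a' + 1 ≤ b`. -/
theorem absT_bal_of_step (A : Finset E → Prop) (O Y : Finset E)
    (hstep : ∀ i j, i + 2 ≤ j → absH A O Y i j ≤ absH A O Y (i + 1) (j - 1)) :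
    ∀ (d a' : ℕ), absT A O Y a' (a' + 1 + d + 1) ≤ absT A O Y (a' + 1) (a' + 1 + d) := by
  intro d
  induction d with
  | zero =>
    intro a'
    -- the diagonal: BAL(a'+1, a'+1) ⟺ STEP(a', a'+2)
    have h := (absH_step_iff_bal A O Y a').mp (hstep a' (a' + 2) le_rfl)
    simpa using h
  | succ d ih =>
    intro a'
    -- write `b := a' + 1 + (d + 1)`; the target is BAL(a'+1, b): T(a', b+1) ≤ T(a'+1, b)
    set b := a' + 1 + (d + 1) with hb
    -- STEP(a', b+1): H(a', b+1) ≤ H(a'+1, b)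
    have hs : absH A O Y a' (b + 1) ≤ absH A O Y (a' + 1) b := by
      have := hstep a' (b + 1) (by omega)
      convert this using 2
      omega
    -- the tails split at the red level
    have e1 : absT A O Y a' (b + 1) = absT A O Y (a' + 1) (b + 1) + absH A O Y a' (b + 1) :=
      absT_eq_add_absH A O Y a' (b + 1)
    have e2 : absT A O Y (a' + 1) b = absT A O Y (a' + 1 + 1) b + absH A O Y (a' + 1) b :=
      absT_eq_add_absH A O Y (a' + 1) b
    -- the induction hypothesis at `a' + 1`: BAL(a'+2, b): T(a'+1, b+1) ≤ T(a'+2, b)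
    have hi : absT A O Y (a' + 1) (b + 1) ≤ absT A O Y (a' + 1 + 1) b := by
      have := ih (a' + 1)
      convert this using 2 <;> omega
    show absT A O Y a' (b + 1) ≤ absT A O Y (a' + 1) b
    omega

end StepZero

end Summit.Ventures.PercRepro2
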